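import Mathlib
import Summits.ValiantsHypothesis.ValiantsHypothesis.Theorems.ZeroOneTransfer.Negative.TopComponentFree
import Summits.ValiantsHypothesis.ValiantsHypothesis.Theorems.DivisionGapPerMultiplesHardStubRowConcentration
import Summits.ValiantsHypothesis.ValiantsHypothesis.Theorems.DivisionGapPerMultiplesHardStubFaceDescent
import Literature.Computability.AlgebraicComplexity.RealTauConjectureDepthFour
import Literature.Computability.AlgebraicComplexity.ArithCircuitProofs
import Literature.Computability.AlgebraicComplexity.PermanentIrreducible

/-!
# `DivisionGap.PerMultiplesHard` (stmt-ValiantsHypothesis-5068), line `uncharged-face-walk`: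
the block-projection lever (stub `stub_blockProjection`)

Let `h ≠ 0` be a multiplier over `ℝ≥0` all of whose exponents have total degree `D`, and let
`A` (rows) and `B` (columns) be sets of the same size `a`.  A cell `(x, y)` is BLOCK-DIAGONAL when
`x ∈ A ↔ y ∈ B` (it lies in `A × B` or in `Aᶜ × Bᶜ`).  Suppose `h` has an exponent living on
block-diagonal cells and all such exponents agree with `u` on `A × B`.  Then for the transport
`u'` of `u|_{A × B}` to the `a`-board, `L⁺(x^{u'} · per_a) ≤ L⁺(per_n · h) + 1` for the tree's
monotone fan-in-two `complexity` over `ℝ≥0`.  All moves are free over `ℝ≥0`: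

1. TOP FORM for the indicator weight `w` of the block-diagonal cells (`topComponent_mul`,
   `complexity_topComponent_le`): a block-diagonal permutation exists (`#A = #B`,
   `Equiv.extendSubtype`), so `top_w per_n = Σ_{σ block-diagonal} x^{μ_σ}`
   (`topComponent_perPoly_eq`), and `top_w h` lives on block-diagonal cells
   (`conc_of_mem_support_topComponent`).
2. ONE PROJECTION onto the `a`-board (`IsProjection.complexity_le_holds`): the cell
   `(eA s, eB t)` of `A × B` goes to `X (s, t)`, every other cell to `1`.  Then
   `top_w h ↦ c · x^{u'}` with `c ≠ 0`, and `x^{μ_σ} ↦ x^{μ_π}` for the permutation `π` of the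
   `a`-board induced by a block-diagonal `σ` on `B → A`.  AVERAGING over the right action of
   `Perm (Fin a)` (extended to `Fin n` along `eB`, `Equiv.Perm.extendDomain`), under which the
   induced permutation of `σ · ρ̂` is `π · ρ`, gives `a! · prj (top_w per_n) = N · per_a`, `N ≠ 0`
   the number of block-diagonal permutations — no fibre counting.
3. RESCALE (`complexity_smul_le_holds`, one gate).  [folklore]
-/

noncomputable section

open MvPolynomial Literature.Computability.AlgebraicComplexity
open scoped NNReal BigOperators
open Summit.ValiantsHypothesis.ValiantsHypothesis.Theorems.ZeroOneTransfer.Negative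
open Summit.ValiantsHypothesis.ValiantsHypothesis.Theorems.DivisionGap.PerMultiplesHard.FaceDescent
  (sum_coeff_ne_zero topComponent_perPoly_eq)
open Summit.ValiantsHypothesis.ValiantsHypothesis.Theorems.DivisionGap.PerMultiplesHard.RowConcentration
  (conc_of_mem_support_topComponent monomial_permMonomial)

set_option linter.dupNamespace false

namespace Summit.ValiantsHypothesis.ValiantsHypothesis.Theorems.DivisionGap.PerMultiplesHard.BlockProjection

variable {n a : ℕ} {A B : Finset (Fin n)}

/-! ### Block-diagonal permutations -/

/-- If `B ≃ A` there is a block-diagonal permutation: `σ i ∈ A ↔ i ∈ B`. [folklore] -/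
theorem exists_blockDiag_perm (e : {x // x ∈ B} ≃ {x // x ∈ A}) :
    ∃ σ : Equiv.Perm (Fin n), ∀ i, (σ i ∈ A ↔ i ∈ B) := by
  refine ⟨e.extendSubtype, fun i => ?_⟩
  by_cases hi : i ∈ B
  · exact iff_of_true (e.extendSubtype_mem i hi) hi
  · exact iff_of_false (e.extendSubtype_not_mem i hi) hi

variable (eA : Fin a ≃ {x // x ∈ A}) (eB : Fin a ≃ {x // x ∈ B})

/-- A block-diagonal `σ` induces a permutation `π` of the `a`-board on `B → A`:
`eA (π t) = σ (eB t)`. [folklore] -/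
theorem exists_induced {σ : Equiv.Perm (Fin n)} (hσ : ∀ i, (σ i ∈ A ↔ i ∈ B)) :
    ∃ π : Equiv.Perm (Fin a), ∀ t, (eA (π t) : Fin n) = σ (eB t) :=
  ⟨(eB.trans (σ.subtypeEquiv (p := (· ∈ B)) (q := (· ∈ A)) fun i => (hσ i).symm)).trans
    eA.symm, fun t => by simp⟩

/-- The extension `ρ̂` of `ρ : Perm (Fin a)` along `eB` preserves `B`. [folklore] -/
theorem extendDomain_mem_iff (ρ : Equiv.Perm (Fin a)) (i : Fin n) :
    (ρ.extendDomain eB i ∈ B ↔ i ∈ B) := by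
  by_cases hi : i ∈ B
  · rw [Equiv.Perm.extendDomain_apply_subtype _ _ hi]
    exact iff_of_true (eB _).2 hi
  · rw [Equiv.Perm.extendDomain_apply_not_subtype _ _ hi]

/-- `σ · ρ̂` is block-diagonal iff `σ` is. [folklore] -/
theorem blockDiag_mul_iff (σ : Equiv.Perm (Fin n)) (ρ : Equiv.Perm (Fin a)) :
    (∀ i, ((σ * ρ.extendDomain eB) i ∈ A ↔ i ∈ B)) ↔ ∀ i, (σ i ∈ A ↔ i ∈ B) := by
  simp only [Equiv.Perm.mul_apply]
  refine ⟨fun h j => ?_, fun h i => (h _).trans (extendDomain_mem_iff eB ρ i)⟩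
  have h1 := h ((ρ.extendDomain eB).symm j)
  have h2 := extendDomain_mem_iff eB ρ ((ρ.extendDomain eB).symm j)
  rw [Equiv.apply_symm_apply] at h1 h2
  exact h1.trans h2.symm

/-- Equivariance: the permutation induced by `σ · ρ̂` is `π · ρ`. [folklore] -/
theorem induced_mul_extendDomain {σ : Equiv.Perm (Fin n)} {ρ π π' : Equiv.Perm (Fin a)}
    (hπ : ∀ t, (eA (π t) : Fin n) = σ (eB t))
    (hπ' : ∀ t, (eA (π' t) : Fin n) = (σ * ρ.extendDomain eB) (eB t)) : π' = π * ρ := by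
  refine Equiv.ext fun t => eA.injective (Subtype.ext ?_)
  rw [hπ', Equiv.Perm.mul_apply, Equiv.Perm.mul_apply, hπ, Equiv.Perm.extendDomain_apply_image]

/-! ### The projection onto the `a`-board, by specification -/

/-- A projection sending the cell `(eA s, eB t)` to `X (s, t)` and every cell off `A × B` to `1`
maps `c · x^m` to `c · x^{u'}` whenever `m` restricted to `A × B` transports to `u'`.
[folklore] -/
theorem aeval_prj_monomial (prj : Fin n × Fin n → MvPolynomial (Fin a × Fin a) ℝ≥0)
    (hpX : ∀ s t, prj ((eA s : Fin n), (eB t : Fin n)) = X (s, t))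
    (hp1 : ∀ e : Fin n × Fin n, ¬ (e.1 ∈ A ∧ e.2 ∈ B) → prj e = 1)
    {m : (Fin n × Fin n) →₀ ℕ} {u' : (Fin a × Fin a) →₀ ℕ}
    (hmu : ∀ s t, m ((eA s : Fin n), (eB t : Fin n)) = u' (s, t)) (c : ℝ≥0) :
    aeval prj (monomial m c) = C c * monomial u' 1 := by
  rw [aeval_monomial, algebraMap_eq, Finsupp.prod_fintype _ _ (fun _ => pow_zero _)]
  congr 1
  rw [monomial_eq, C_1, one_mul, Finsupp.prod_fintype _ _ (fun _ => pow_zero _),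
    ← Finset.prod_mul_prod_compl (A ×ˢ B), Finset.prod_eq_one (s := (A ×ˢ B)ᶜ), mul_one,
    Finset.prod_product, Fintype.prod_prod_type, ← Finset.prod_coe_sort A, ← eA.prod_comp]
  · refine Fintype.prod_congr _ _ fun s => ?_
    rw [← Finset.prod_coe_sort B, ← eB.prod_comp]
    exact Fintype.prod_congr _ _ fun t => by rw [hpX, hmu]
  · intro e he
    rw [hp1 e (fun h => Finset.mem_compl.1 he (Finset.mem_product.2 h)), one_pow]

/-- Such a projection maps a block-diagonal `x^{μ_σ}` onto `x^{μ_π}`, `π` the induced permutation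
of the `a`-board. [folklore] -/
theorem aeval_prj_permMonomial (prj : Fin n × Fin n → MvPolynomial (Fin a × Fin a) ℝ≥0)
    (hpX : ∀ s t, prj ((eA s : Fin n), (eB t : Fin n)) = X (s, t))
    (hp1 : ∀ e : Fin n × Fin n, ¬ (e.1 ∈ A ∧ e.2 ∈ B) → prj e = 1)
    {σ : Equiv.Perm (Fin n)} {π : Equiv.Perm (Fin a)}
    (hπ : ∀ t, (eA (π t) : Fin n) = σ (eB t)) :
    aeval prj (monomial (permMonomial σ) (1 : ℝ≥0)) = monomial (permMonomial π) 1 := by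
  rw [monomial_permMonomial, map_prod, monomial_permMonomial]
  simp only [aeval_X]
  rw [← Finset.prod_mul_prod_compl B, Finset.prod_eq_one (s := Bᶜ), mul_one,
    ← Finset.prod_coe_sort B, ← eB.prod_comp]
  · exact Fintype.prod_congr _ _ fun t => by rw [← hπ t, hpX]
  · exact fun j hj => hp1 _ fun h => Finset.mem_compl.1 hj h.2

/-- **Averaging.** `a! · Σ_{σ block-diagonal} prj (x^{μ_σ}) = N · per_a`, `N` the number of
block-diagonal permutations: reindex by `σ ↦ σ · ρ̂` for each `ρ`, swap the sums, and use
`Σ_ρ x^{μ_{π · ρ}} = per_a`. [folklore] -/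
theorem card_smul_sum_aeval_prj (prj : Fin n × Fin n → MvPolynomial (Fin a × Fin a) ℝ≥0)
    (hpX : ∀ s t, prj ((eA s : Fin n), (eB t : Fin n)) = X (s, t))
    (hp1 : ∀ e : Fin n × Fin n, ¬ (e.1 ∈ A ∧ e.2 ∈ B) → prj e = 1) :
    Fintype.card (Equiv.Perm (Fin a)) •
        ∑ σ ∈ Finset.univ.filter (fun σ : Equiv.Perm (Fin n) => ∀ i, (σ i ∈ A ↔ i ∈ B)),
          aeval prj (monomial (permMonomial σ) (1 : ℝ≥0)) =
      (Finset.univ.filter (fun σ : Equiv.Perm (Fin n) => ∀ i, (σ i ∈ A ↔ i ∈ B))).card •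
        perPoly (Fin a) ℝ≥0 := by
  set BD := Finset.univ.filter (fun σ : Equiv.Perm (Fin n) => ∀ i, (σ i ∈ A ↔ i ∈ B)) with hBD
  have hmem : ∀ σ, σ ∈ BD ↔ ∀ i, (σ i ∈ A ↔ i ∈ B) := fun σ => by
    simp only [hBD, Finset.mem_filter, Finset.mem_univ, true_and]
  set F : Equiv.Perm (Fin n) → MvPolynomial (Fin a × Fin a) ℝ≥0 :=
    fun σ => aeval prj (monomial (permMonomial σ) (1 : ℝ≥0)) with hF
  have h1 : ∀ ρ : Equiv.Perm (Fin a),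
      ∑ σ ∈ BD, F (σ * ρ.extendDomain eB) = ∑ σ ∈ BD, F σ := fun ρ =>
    Finset.sum_equiv (Equiv.mulRight (ρ.extendDomain eB))
      (fun σ => by
        simp only [hmem, Equiv.coe_mulRight]
        exact (blockDiag_mul_iff eB σ ρ).symm)
      (fun σ _ => rfl)
  have h2 : ∀ σ ∈ BD, ∑ ρ : Equiv.Perm (Fin a), F (σ * ρ.extendDomain eB) =
      perPoly (Fin a) ℝ≥0 := by
    intro σ hσ
    obtain ⟨π, hπ⟩ := exists_induced eA eB ((hmem σ).1 hσ)
    rw [perPoly_eq_sum_monomial]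
    refine Fintype.sum_equiv (Equiv.mulLeft π) _ _ fun ρ => ?_
    obtain ⟨π', hπ'⟩ := exists_induced eA eB ((blockDiag_mul_iff eB σ ρ).2 ((hmem σ).1 hσ))
    simp only [hF, Equiv.coe_mulLeft]
    rw [aeval_prj_permMonomial eA eB prj hpX hp1 hπ', induced_mul_extendDomain eA eB hπ hπ']
  calc Fintype.card (Equiv.Perm (Fin a)) • ∑ σ ∈ BD, F σ
      = ∑ _ρ : Equiv.Perm (Fin a), ∑ σ ∈ BD, F σ := by rw [Finset.sum_const, Finset.card_univ]
    _ = ∑ ρ : Equiv.Perm (Fin a), ∑ σ ∈ BD, F (σ * ρ.extendDomain eB) :=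
        Finset.sum_congr rfl fun ρ _ => (h1 ρ).symm
    _ = ∑ σ ∈ BD, ∑ ρ : Equiv.Perm (Fin a), F (σ * ρ.extendDomain eB) := Finset.sum_comm
    _ = ∑ σ ∈ BD, perPoly (Fin a) ℝ≥0 := Finset.sum_congr rfl h2
    _ = BD.card • perPoly (Fin a) ℝ≥0 := Finset.sum_const _

/-! ### The stub -/

/-- **Block projection (stub `stub_blockProjection` of line `uncharged-face-walk`).**  If
`h ≠ 0` is homogeneous in total degree, `#A = #B = a`, some exponent of `h` lives on the
block-diagonal cells of `(A, B)` and all such exponents agree with `u` on `A × B`, then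
`L⁺(x^{u'} · per_a) ≤ L⁺(per_n · h) + 1` for the transport `u'` of `u|_{A × B}`: one free top form
(indicator weight of the block-diagonal cells), one free projection onto the `a`-board (under
which `top h ↦ c · x^{u'}`, `c ≠ 0`, and, by averaging over `Perm (Fin a)`,
`a! · top per_n ↦ N · per_a`, `N ≠ 0`), and one rescaling gate. [folklore] -/
theorem stub_blockProjection :
    ∀ (n : ℕ) (h : MvPolynomial (Fin n × Fin n) ℝ≥0), h ≠ 0 →
      ∀ (D : ℕ), (∀ d ∈ h.support, d.degree = D) →
      ∀ (A B : Finset (Fin n)) (u : (Fin n × Fin n) →₀ ℕ) (a : ℕ), A.card = a → B.card = a →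
        ((∃ m ∈ h.support, ∀ e ∈ m.support, (e.1 ∈ A ↔ e.2 ∈ B)) ∧
          ∀ m ∈ h.support, (∀ e ∈ m.support, (e.1 ∈ A ↔ e.2 ∈ B)) →
            ∀ e : Fin n × Fin n, e.1 ∈ A → e.2 ∈ B → m e = u e) →
        ∃ u' : (Fin a × Fin a) →₀ ℕ,
          complexity (monomial u' (1 : ℝ≥0) * perPoly (Fin a) ℝ≥0) ≤
            complexity (perPoly (Fin n) ℝ≥0 * h) + 1 := by
  intro n h hh D hdeg A B u a hA hB hyp
  classical
  obtain ⟨⟨m₀, hm₀, hm₀c⟩, hu⟩ := hyp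
  -- enumerations of `A` and `B`; the transported exponent; a block-diagonal permutation
  set eA : Fin a ≃ {x // x ∈ A} := (A.orderIsoOfFin hA).toEquiv
  set eB : Fin a ≃ {x // x ∈ B} := (B.orderIsoOfFin hB).toEquiv
  obtain ⟨u', hu'⟩ : ∃ u' : (Fin a × Fin a) →₀ ℕ, ∀ s t, u' (s, t) = u (eA s, eB t) :=
    ⟨Finsupp.equivFunOnFinite.symm fun pq => u (eA pq.1, eB pq.2), fun s t => rfl⟩
  refine ⟨u', ?_⟩
  obtain ⟨σ₀, hσ₀⟩ := exists_blockDiag_perm (eB.symm.trans eA)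
  -- the projection, by specification
  obtain ⟨prj, hpX, hp1, hpP⟩ : ∃ prj : Fin n × Fin n → MvPolynomial (Fin a × Fin a) ℝ≥0,
      (∀ s t, prj ((eA s : Fin n), (eB t : Fin n)) = X (s, t)) ∧
      (∀ e : Fin n × Fin n, ¬ (e.1 ∈ A ∧ e.2 ∈ B) → prj e = 1) ∧
      ∀ e, (∃ v, prj e = X v) ∨ ∃ c, prj e = C c := by
    refine ⟨fun e => if hx : e.1 ∈ A ∧ e.2 ∈ B then
      X (eA.symm ⟨e.1, hx.1⟩, eB.symm ⟨e.2, hx.2⟩) else 1, fun s t => ?_, fun e he => dif_neg he,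
      fun e => ?_⟩
    · dsimp only
      rw [dif_pos ⟨(eA s).2, (eB t).2⟩]
      simp
    · dsimp only
      by_cases he : e.1 ∈ A ∧ e.2 ∈ B
      · exact Or.inl ⟨_, dif_pos he⟩
      · exact Or.inr ⟨1, by rw [dif_neg he, C_1]⟩
  have havg := card_smul_sum_aeval_prj eA eB prj hpX hp1
  set BD := Finset.univ.filter (fun σ : Equiv.Perm (Fin n) => ∀ i, (σ i ∈ A ↔ i ∈ B)) with hBD
  have hN : BD.card ≠ 0 :=
    Finset.card_ne_zero.2 ⟨σ₀, by rw [hBD]; exact Finset.mem_filter.2 ⟨Finset.mem_univ _, hσ₀⟩⟩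
  -- (1) the weight: top forms
  set w : Fin n × Fin n → ℕ := fun e => if (e.1 ∈ A ↔ e.2 ∈ B) then 1 else 0 with hw
  set G : Finset (Fin n × Fin n) := Finset.univ.filter fun e => (e.1 ∈ A ↔ e.2 ∈ B) with hG
  have hwP : ∀ e : Fin n × Fin n, (e.1 ∈ A ↔ e.2 ∈ B) → w e = 1 := fun e he => by
    simp only [hw]
    exact if_pos he
  have hw0 : ∀ e : Fin n × Fin n, ¬ (e.1 ∈ A ↔ e.2 ∈ B) → w e = 0 := fun e he => by
    simp only [hw]
    exact if_neg he
  have hw1 : ∀ e, w e ≤ 1 := fun e => by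
    simp only [hw]
    split_ifs <;> simp
  have hcut : ∀ σ : Equiv.Perm (Fin n), (∀ i, (σ i, i) ∈ G) ↔
      ∀ τ : Equiv.Perm (Fin n), (∑ i, w (τ i, i)) ≤ ∑ i, w (σ i, i) := by
    intro σ
    have hGi : ∀ i, (σ i, i) ∈ G ↔ (σ i ∈ A ↔ i ∈ B) := fun i => by simp [hG]
    simp only [hGi]
    constructor
    · intro hσ τ
      exact Finset.sum_le_sum fun i _ => (hw1 _).trans (hwP _ (hσ i)).ge
    · intro hle
      by_contra hne
      obtain ⟨i₀, hi₀⟩ := not_forall.1 hne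
      refine absurd (hle σ₀) (not_le.2 (Finset.sum_lt_sum (fun i _ => ?_)
        ⟨i₀, Finset.mem_univ _, ?_⟩))
      · exact (hw1 _).trans (hwP _ (hσ₀ i)).ge
      · rw [hw0 _ hi₀, hwP _ (hσ₀ i₀)]
        exact zero_lt_one
  have htopP : topComponent w (perPoly (Fin n) ℝ≥0) =
      ∑ σ ∈ BD, monomial (permMonomial σ) (1 : ℝ≥0) := by
    rw [topComponent_perPoly_eq G w hcut, hBD]
    exact Finset.sum_congr (Finset.filter_congr fun σ _ => by simp [hG]) fun _ _ => rfl
  have hconcT : ∀ d ∈ (topComponent w h).support, ∀ e ∈ d.support, (e.1 ∈ A ↔ e.2 ∈ B) :=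
    fun d hd => conc_of_mem_support_topComponent hdeg (fun e => (e.1 ∈ A ↔ e.2 ∈ B)) hm₀
      hm₀c hd
  -- (2) the images under the projection
  set c : ℝ≥0 := ∑ d ∈ (topComponent w h).support, coeff d (topComponent w h) with hc
  have hc0 : c ≠ 0 := sum_coeff_ne_zero (topComponent_ne_zero w hh)
  have htopH : aeval prj (topComponent w h) = C c * monomial u' 1 := by
    conv_lhs => rw [(topComponent w h).as_sum]
    rw [map_sum, hc, map_sum, Finset.sum_mul]
    refine Finset.sum_congr rfl fun d hd => aeval_prj_monomial eA eB prj hpX hp1 (fun s t => ?_) _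
    rw [hu', hu d (support_topComponent_subset w h hd) (hconcT d hd) _ (eA s).2 (eB t).2]
  have hS : aeval prj (topComponent w (perPoly (Fin n) ℝ≥0)) =
      ∑ σ ∈ BD, aeval prj (monomial (permMonomial σ) (1 : ℝ≥0)) := by
    rw [htopP, map_sum]
  have hMS : ((Fintype.card (Equiv.Perm (Fin a)) : ℕ) : ℝ≥0) •
      (∑ σ ∈ BD, aeval prj (monomial (permMonomial σ) (1 : ℝ≥0))) =
      ((BD.card : ℕ) : ℝ≥0) • perPoly (Fin a) ℝ≥0 := by
    rw [Nat.cast_smul_eq_nsmul, Nat.cast_smul_eq_nsmul]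
    exact havg
  -- the scalar identity `(N c) • (x^{u'} per_a) = a! • prj (top (per_n h))`
  set Gp := aeval prj (topComponent w (perPoly (Fin n) ℝ≥0 * h)) with hGp
  have hid : (((BD.card : ℕ) : ℝ≥0) * c) • (monomial u' (1 : ℝ≥0) * perPoly (Fin a) ℝ≥0) =
      ((Fintype.card (Equiv.Perm (Fin a)) : ℕ) : ℝ≥0) • Gp := by
    rw [hGp, topComponent_mul, map_mul, hS, htopH]
    calc (((BD.card : ℕ) : ℝ≥0) * c) • (monomial u' (1 : ℝ≥0) * perPoly (Fin a) ℝ≥0)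
        = C c * monomial u' 1 * (((BD.card : ℕ) : ℝ≥0) • perPoly (Fin a) ℝ≥0) := by
          rw [smul_eq_C_mul, smul_eq_C_mul, map_mul]
          ring
      _ = C c * monomial u' 1 * (((Fintype.card (Equiv.Perm (Fin a)) : ℕ) : ℝ≥0) •
            ∑ σ ∈ BD, aeval prj (monomial (permMonomial σ) (1 : ℝ≥0))) := by rw [hMS]
      _ = _ := by
          rw [smul_eq_C_mul, smul_eq_C_mul]
          ring
  have hNc : ((BD.card : ℕ) : ℝ≥0) * c ≠ 0 := mul_ne_zero (Nat.cast_ne_zero.2 hN) hc0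
  have hκ : monomial u' (1 : ℝ≥0) * perPoly (Fin a) ℝ≥0 =
      ((((BD.card : ℕ) : ℝ≥0) * c)⁻¹ * ((Fintype.card (Equiv.Perm (Fin a)) : ℕ) : ℝ≥0)) • Gp := by
    rw [← smul_smul, ← hid, inv_smul_smul₀ hNc]
  -- (3) finish: top form free, projection free, one rescaling gate
  have h1 : complexity Gp ≤ complexity (topComponent w (perPoly (Fin n) ℝ≥0 * h)) :=
    IsProjection.complexity_le_holds ⟨prj, hpP, hGp⟩
  have h2 := complexity_topComponent_le w (perPoly (Fin n) ℝ≥0 * h)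
  have h3 := complexity_smul_le_holds
    ((((BD.card : ℕ) : ℝ≥0) * c)⁻¹ * ((Fintype.card (Equiv.Perm (Fin a)) : ℕ) : ℝ≥0)) Gp
  rw [hκ]
  omega

end Summit.ValiantsHypothesis.ValiantsHypothesis.Theorems.DivisionGap.PerMultiplesHard.BlockProjection

end
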